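import Summits.Ventures.HSemireg.WeilFramePolarisationVolume
import Summits.Ventures.HSemireg.WeilFrameWedgeToCupMul

/-!
# Venture HSemireg — THEOREM R on the real carriers with the volume hypothesis stated in cohomology:
# `h^{2n} ≠ 0` in `H^{4n}(A(ℂ); ℂ)` (`cupPowTwo h (2n) ≠ 0`)

HONEST FRAMING. Part of the Lean index of the computation cell `pub-hsemireg` (seat w3-mod4-1 gen 8, W3 SPECIAL FIBRES,
MOD4-OFFSPLIT §13). The Literature layer `AlgebraicTopology/SingularHomology` (the comparison `wedgeToCup`, `cupPowOne`,
`cupProduct`, `cupPowTwo`) and the tree's real carriers ONLY: no semiregularity map; nothing here says that HC / HC_CM / HC_AV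
holds; nothing here is a claim about any explicit variety; no Literature fact is declared; NO definition is introduced.

WHAT IS PROVED. By `wedgeToCup_pow_two` (`WeilFrameWedgeToCupMul.lean`: `∧ ↦ ⌣` is multiplicative, so `ĥ^m` reads `h^m`), on an
abelian variety `exteriorOf_pow_ne_zero_of_cupPowTwo_ne_zero`: `h^m ≠ 0 ⇒ ĥ^m ≠ 0` for `ĥ = (equiv A 2)⁻¹ h` read in `ΛH¹`.
So the volume hypothesis of `contractionRank_weilType_of_volume` may be stated in cohomology:
**`contractionRank_weilType_of_cupPowTwo`** — THEOREM R on the real carriers for `A` of dimension `2n ≥ 6` with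
`φ ≫ φ = -(d • 𝟙 A)`, balanced type, a `K`-symmetric `(1,1)`-class `h` with `cupPowTwo h (2n) ≠ 0` («`h^{2n} ≠ 0`»), non-zero Weil
classes `c± ∈ E±`, and total class `Σ (q_m/m!) ĥ^m + ĉ₊ + ĉ₋`: `contractionRank A κ = 4n² + n²·rank H₂(q) - 2n`.
Everything PROVED, 0 sorry.
References: [LangeBirkenhake1992] Lemma 1.1.17, Exercise 1.1.6 (7); [Hatcher2002] §3.2; [BuchweitzFlenner2008HH] Prop. 6.4.4.
-/

noncomputable section

open CliffordAlgebra (contractLeft)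
open ExteriorAlgebra (ι)
open Module CategoryTheory
open Literature.AlgebraicGeometry.Motives Literature.AlgebraicGeometry.HodgeTheory
open Literature.AlgebraicTopology.SingularHomology

namespace Summit.Ventures.HSemireg.WeilFrame

open Summit.Ventures.HSemireg.Wedge.Hankel

/-! ### Real carriers: the volume hypothesis in cohomology -/

variable {A : AbelianVariety ℂ}

/-- **`h^m ≠ 0 ⇒ ĥ^m ≠ 0`** for `ĥ = (equiv A 2)⁻¹ h` read in `ΛH¹(A)`. [cite: LangeBirkenhake1992, Exercise 1.1.6 (7)] -/
theorem exteriorOf_pow_ne_zero_of_cupPowTwo_ne_zero {h : complexBetti A.X 2} {m : ℕ} (hm : cupPowTwo h m ≠ 0) :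
    ((⋀[ℂ]^2 (complexBetti A.X 1)).subtype ((abelianVarietyCohomologyExteriorH1_holds.equiv A 2).symm h)) ^ m ≠ 0 := by
  set x := (abelianVarietyCohomologyExteriorH1_holds.equiv A 2).symm h with hxdef
  intro h0
  apply hm
  have hx2 : wedgeToCup ℂ (ComplexPoints A.X) 2 ⟨(x : ExteriorAlgebra ℂ (complexBetti A.X 1)), x.2⟩ = h := by
    rw [Subtype.coe_eta, ← abelianVarietyCohomologyExteriorH1.equiv_apply abelianVarietyCohomologyExteriorH1_holds A 2, hxdef,
      LinearEquiv.apply_symm_apply]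
  have hpow := wedgeToCup_pow_two (ComplexPoints A.X) x.2 m
  rw [hx2] at hpow
  rw [← hpow]
  have hz : (⟨(x : ExteriorAlgebra ℂ (complexBetti A.X 1)) ^ m, pow_mem_exteriorPower_two_mul ℂ x.2 m⟩ :
      ⋀[ℂ]^(2 * m) (complexBetti A.X 1)) = 0 :=
    Subtype.ext (by
      change (x : ExteriorAlgebra ℂ (complexBetti A.X 1)) ^ m = 0
      rw [Submodule.subtype_apply] at h0; exact h0)
  rw [hz, map_zero]

/-- **THEOREM R on the real carriers — Weil type `(n, n)`, the volume stated in cohomology** (`n ≥ 3`): as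
`contractionRank_weilType_of_volume`, with `ĥ^{2n} ≠ 0` replaced by `cupPowTwo h (2n) ≠ 0` (`h^{2n} ≠ 0` in `H^{4n}(A(ℂ); ℂ)`).
[cite: vanGeemen1994HodgeAV, 4.9 and Lemma 5.2] [cite: BuchweitzFlenner2008HH, Prop. 6.4.4] [cite: MumfordAV1970, §1 (4) and §4 (iii)] -/
theorem contractionRank_weilType_of_cupPowTwo (hA : IsSmoothProjective A.dim A.X)
    (κ : ∀ p : ℕ, complexBetti A.X (2 * p)) {n d : ℕ} (hn : 3 ≤ n) (hdim : A.dim = n + n) (hd : 0 < d) {φ : A ⟶ A}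
    (hφ : φ ≫ φ = -(d • 𝟙 A)) {P Q : Submodule ℂ (complexBetti A.X 1)}
    (hP : P = Module.End.eigenspace (complexBetti.map φ.hom.hom.hom 1).hom (Complex.I * (Real.sqrt d : ℂ)))
    (hQ : Q = Module.End.eigenspace (complexBetti.map φ.hom.hom.hom 1).hom (-(Complex.I * (Real.sqrt d : ℂ))))
    (hp : finrank ℂ ↥(P ⊓ hodgeOneZero hA) = n) {h : complexBetti A.X 2}
    (hh : complexBetti.map φ.hom.hom.hom 2 h = (d : ℂ) • h) (h11 : IsOfHodgeType A.dim A.X 2 1 1 h)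
    (hvol : cupPowTwo h (n + n) ≠ 0)
    {cP cQ : complexBetti A.X (2 * n)} (hcP : cP ∈ weilClassesPlus A φ n d) (hcP0 : cP ≠ 0)
    (hcQ : cQ ∈ weilClassesMinus A φ n d) (hcQ0 : cQ ≠ 0) (q : ℕ → ℂ)
    (hx : totalExteriorClass A κ = (∑ m ∈ Finset.range (n + n + 1), (q m * ((m.factorial : ℕ) : ℂ)⁻¹) •
        ((⋀[ℂ]^2 (complexBetti A.X 1)).subtype ((abelianVarietyCohomologyExteriorH1_holds.equiv A 2).symm h)) ^ m) +
      (⋀[ℂ]^(2 * n) (complexBetti A.X 1)).subtype ((abelianVarietyCohomologyExteriorH1_holds.equiv A (2 * n)).symm cP) +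
      (⋀[ℂ]^(2 * n) (complexBetti A.X 1)).subtype ((abelianVarietyCohomologyExteriorH1_holds.equiv A (2 * n)).symm cQ)) :
    contractionRank A κ = ((4 * (n * n) + n * n * (hankel1 ℂ (n + n) 2 q).rank - 2 * n : ℕ) : Cardinal) :=
  contractionRank_weilType_of_volume hA κ hn hdim hd hφ hP hQ hp hh h11 (exteriorOf_pow_ne_zero_of_cupPowTwo_ne_zero hvol)
    hcP hcP0 hcQ hcQ0 q hx

end Summit.Ventures.HSemireg.WeilFrame

end
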